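import Summits.BirchSwinnertonDyer.Rank1Residual.X11b.ChaRoute
import Summits.BirchSwinnertonDyer.BirchSwinnertonDyer.Theorems.Rank1ResidualX9JetchevCha
import HarnessLib

/-!
# BSD rank-≤1 residual cell, class X11b (`r = 1 ∧ p ≠ 2 ∧ mult ∧ irr`): the TAMAGAWA-OBSTRUCTED
# pairs — Miller 2011 Thm. 5.4 (Jetchev's sharpening) under Cha's hypotheses, at a MULTIPLICATIVE prime

HONEST FRAMING (cell `b2b-bsdres-*`, run/shared/lean/b2b/bsd-rank1-residual/, verbatim): the goal
of the cell is to DELETE the COMBINATION-SHAPED residual classes for ALL analytic-rank `≤ 1` elliptic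
curves over `ℚ` — "full BSD formula for every rank `≤ 1` curve in class C" assembled STRICTLY from
published theorems — so that the rank-`≤ 1` remainder becomes exactly the CONSTRUCTION-SHAPED
classes, which are TYPED (missing-input Props), NOT attempted; this is not "finishing BSD".
Prove what is provable now; shrink each hard class to its core with data; no claim beyond stated
classes. Research route of unit `b2b-bsdres-x11c` (gen 4); class X11b stays CONSTRUCTION-SHAPED; this
file is PER PAIR (a certificate shape), not a class theorem; no named fact is introduced.

## What this file does

After the Cha route (`X11b/ChaRoute.lean`, gen 3: 24 of the unit's 64 RESISTANT pairs at `p = 5` —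
`ρ̄_{E,5}` irreducible NOT surjective, images `5S4`/`5Ns`, no (ram) witness — carry a two-engine
certificate `5 ∤ [E(K) : ℤ y_K]`), the 40 remaining pairs are exactly those where `5 ∣ c_q(E)` for a
bad prime `q`: there Gross–Zagier and the BSD shape over the Heegner field `K` force
`5 ∣ [E(K) : ℤ y_K]` in EVERY Heegner field (HOME/b2b-bsdres-x11c/REPORT.md §11: 97 `BOUND` rows, two
engines), so Cha's bound alone can never certify `Ш(E/ℚ)[5] = 0`. The PRINTED lever for exactly this
situation is D. Jetchev's Tamagawa sharpening of the Heegner-index bound in the form printed by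
R. L. Miller, LMS J. Comput. Math. 14 (2011) Thm. 5.4: "If the hypotheses of any of Theorems 5.1,
5.2 or 5.3 apply to `p`, then `ord_p(#Ш(ℚ,E)) ≤ 2·(ord_p(I_K) − max_{q∣N} ord_p(c_q))`", under the
hypotheses of Thm. 5.2 (Cha: `r_an ≤ 1`, `p ∤ 2·Δ(K)`, `p² ∤ N`, `ρ̄_{E,p}` irreducible) — the tree's
named fact `Miller2011.thm54_cha_padicValNat_shaOrder_add_tamagawa_le` (x9 gen 7), carrying the
FLAG `Miller11-Thm54-Cha-case` (the printed proof is the citation of Jetchev, Compos. Math. 144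
(2008), whose Thm. 1.4 / Cor. 1.5 are printed under Hypothesis (\*): `p ∤ N`, `ρ̄` surjective).
Its reduction hypothesis is Cha's `p² ∤ N`: a MULTIPLICATIVE `p` is allowed by the printed statement.
On class X11b (this file) a SECOND flag is therefore recorded, `JET@p|N` (the lane's name,
bsdN/HYPOTHESES.md v2, referee A G28): the pair has `p ∥ N`, outside Jetchev's printed (\*); in 36
of the unit's 40 pairs the Tamagawa prime `q` with `p ∣ c_q` is `q = p = 5` itself (split `I₅`/`I₁₀`
at `5`). Pairs closed through this file are to be booked with BOTH flags, at the referee's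
discretion (literal tier or PUB), never silently — exactly as the lane books row T-JET.

* `bsdp_of_mult_of_jetchevChaCertificate` — for ANY globally minimal elliptic `W/ℚ` of analytic
  rank `≤ 1`, an odd prime `p` of multiplicative reduction with `E[p]` irreducible, an imaginary
  quadratic `K` with the Heegner hypothesis for the level `N` and `p ∤ d_K`, `p² ∤ N`, a Heegner
  point `y_K = P` of infinite order, ONE prime `q ∣ N` with `ord_p [E(K) : ℤ P] ≤ ord_p c_q(E)`, and
  `p ∤ #Ш_an`: Miller's `BSD(E,p)` — from x9's consumer
  `bsdp_of_millerJetchev_of_index_le_tamagawa` with the non-CM hypothesis DISCHARGED from `Mult W p`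
  (`not_mult_of_hasCM`, Silverman ATAEC II.6.4).
* `bsdp_of_mult_of_jetchevChaCertificate_of_carayol` — the same with `p² ∤ N` discharged by Carayol's
  theorem (`N = N_E`, `X11b.not_sq_dvd_level_of_isHeegnerPoint`).
* `ClassX11b.bsdp_of_jetchevChaCertificate` (`_of_carayol`) — on the cell's v5 class
  `ClassX11b W p := r = 1 ∧ p ≠ 2 ∧ Mult W p ∧ Irr W p` every Galois / reduction hypothesis is
  automatic; what remains per pair is the finite certificate (`K`, `y_K`, `q`,
  `ord_p index ≤ ord_p c_q`) and `p ∤ #Ш_an`.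
* `ClassX11b.padicValNat_shaOrder_le_of_jetchevCha` — the numeric form `ord_p #Ш(E/ℚ) ≤ 2(v − w)`
  from `ord_p [E(K):ℤP] ≤ v`, `w ≤ ord_p c_q` (records what is PRINTED for the pairs that stay:
  two Tamagawa primes with `5 ∥ c_q` each and `ord₅ m = 2` give only `ord₅ #Ш ≤ 2`).
* `ClassX11b.missingPPartAt_of_jetchevChaCertificate` — bookkeeping in the typed currency.

Scope (numbers, not adjectives; HOME/b2b-bsdres-x11c/REPORT.md §12): of the 40 Tamagawa-obstructed
pairs, 36 carry the certificate with an already two-engine-agreed Heegner row (`ord₅ m = 1 = ord₅ c_q`;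
gen 3 jobs j077797/j077800 = j077966–j077972) and one more (`169920dc1`, `K = ℚ(√-431)`, `q = 59`)
with an engine-1 row re-run on engine 2 in gen 4; three STAY (`84960d1`, `296240ce1`, `304560by1`:
two bad primes with `5 ∥ c_q` each, `ord₅ m = 2` in every field, Jetchev's `max`-form leaves
`ord₅ #Ш ≤ 2`). The per-pair theorems are `X11b/JetchevChaPairs*.lean`.

References: R. L. Miller, LMS J. Comput. Math. 14 (2011) Thm. 5.4, Thm. 5.2, Def. 1.1
[Miller2011LMS]; D. Jetchev, Compos. Math. 144 (2008) 811–826, Hypothesis (\*), Thm. 1.4, Cor. 1.5,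
Rem. 6.2 [Jetchev2008]; B. Cha, J. Number Theory 111 (2005) [Cha2005]; H. Carayol, Ann. Sci. ÉNS 19
(1986) [Carayol1986]; J. H. Silverman, *Advanced Topics* (1994) II.6.4 [SilvermanATAEC1994]; x9's
`Theorems/Rank1ResidualX9JetchevCha.lean`; this unit's `X11b/ChaRoute.lean`.
-/

noncomputable section

open scoped Classical

open WeierstrassCurve Literature.NumberTheory.EllipticCurves
  Literature.NumberTheory.EllipticCurves.ModularForms
  Literature.NumberTheory.EllipticCurves.Rank1Residual
  Literature.NumberTheory.EllipticCurves.Rank1Residual.Typed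
  Literature.NumberTheory.EllipticCurves.Miller2011
  Summit.BirchSwinnertonDyer.BirchSwinnertonDyer.Rank1Residual

namespace Summit.BirchSwinnertonDyer.Rank1Residual.X11b

variable (W : WeierstrassCurve ℚ) [W.IsElliptic] [W.IsGloballyMinimal] (p : ℕ) [Fact p.Prime]

/-! ### §1. The Jetchev–Cha certificate at a multiplicative prime -/

/-- **`BSD(E,p)` from the Jetchev–Cha index certificate at an odd MULTIPLICATIVE prime with `E[p]`
irreducible** (image NOT necessarily surjective). PUBLISHED binders: Miller 2011 Thm. 5.4 under the
hypotheses of Thm. 5.2 (`hMJ`, tree fact `thm54_cha_padicValNat_shaOrder_add_tamagawa_le`, FLAGS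
`Miller11-Thm54-Cha-case` and — here, `p ∥ N` — `JET@p|N`) and Gross–Zagier–Kolyvagin (`hGZK`,
bsd.S17). Certificate: `K` imaginary quadratic with the Heegner hypothesis for the level `N` and
`p ∤ d_K`, `p² ∤ N`, a Heegner point `P = y_K` of infinite order, ONE prime `q ∣ N` with
`ord_p [E(K) : ℤ P] ≤ ord_p c_q(E)` (`c_q` = the local Tamagawa number of `W ⊗ ℚ_q` on its
`ℤ_q`-minimal model), `r_an(E) ≤ 1` and `#Ш_an = s` with `ord_p s = 0`. The non-CM hypothesis of
Cha's theorem is discharged: a CM curve has no multiplicative prime (`not_mult_of_hasCM`, Silverman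
ATAEC II.6.4). Per pair; not a class theorem.
[cite: Miller2011LMS, Thm. 5.4 (arXiv:1010.2431 p. 11) and Def. 1.1]
[cite: Jetchev2008, Hypothesis (*), Cor. 1.5 (p. 3), Rem. 6.2 (p. 15)]
[cite: SilvermanATAEC1994, Thm. II.6.4 (PDF p. 148)] -/
theorem bsdp_of_mult_of_jetchevChaCertificate (hMJ : thm54_cha_padicValNat_shaOrder_add_tamagawa_le)
    (hGZK : rank_eq_analyticRank_of_analyticRank_le_one)
    (hmult : Mult W p) (hp2 : p ≠ 2) (hirr : Irr W p)
    {N : ℕ} [NeZero N] {K : Type} [Field K] [NumberField K] (hK : IsImaginaryQuadratic K)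
    (hH : SatisfiesHeegnerHypothesis N K) {P : (W.baseChange K).toAffine.Point}
    (hP : IsHeegnerPoint N W K P) (hnt : ¬ IsOfFinAddOrder P)
    (hpD : ¬ (p : ℤ) ∣ NumberField.discr K) (hpN : ¬ p ^ 2 ∣ N)
    (q : ℕ) [Fact q.Prime] (hqN : q ∣ N)
    (hI : padicValNat p (AddSubgroup.zmultiples P).index ≤
      padicValNat p ((W.baseChange ℚ_[q]).localTamagawaNumber ℤ_[q]))
    (hr : W.analyticRank ≤ 1) {s : ℚ} (hs : shaAn W = (s : ℂ)) (hv : padicValRat p s = 0) :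
    BSDp W p :=
  bsdp_of_millerJetchev_of_index_le_tamagawa hMJ hGZK W p hK hH hP hnt q hqN
    (fun hCM ↦ not_mult_of_hasCM W hCM p hmult) hp2 hpD hpN hirr hI hr hs hv

/-- **`BSD(E,p)` from the Jetchev–Cha certificate at an odd multiplicative prime, `p² ∤ N`
discharged by Carayol's theorem** (`hC`, tree named fact `IsNewformOf.level_eq_conductorNorm`: the
level of the parametrisation datum is `N_E`, and `f_p(E) = 1` at a multiplicative prime;
`X11b.not_sq_dvd_level_of_isHeegnerPoint`). Same certificate as
`bsdp_of_mult_of_jetchevChaCertificate` minus the binder `hpN`. FLAGS `Miller11-Thm54-Cha-case`,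
`JET@p|N`. Per pair; not a class theorem.
[cite: Miller2011LMS, Thm. 5.4 and Def. 1.1] [cite: Carayol1986, Thm. (A)] -/
theorem bsdp_of_mult_of_jetchevChaCertificate_of_carayol
    (hMJ : thm54_cha_padicValNat_shaOrder_add_tamagawa_le)
    (hGZK : rank_eq_analyticRank_of_analyticRank_le_one)
    (hC : ∀ (M : ℕ) [NeZero M], IsNewformOf.level_eq_conductorNorm (N := M))
    (hmult : Mult W p) (hp2 : p ≠ 2) (hirr : Irr W p)
    {N : ℕ} [NeZero N] {K : Type} [Field K] [NumberField K] (hK : IsImaginaryQuadratic K)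
    (hH : SatisfiesHeegnerHypothesis N K) {P : (W.baseChange K).toAffine.Point}
    (hP : IsHeegnerPoint N W K P) (hnt : ¬ IsOfFinAddOrder P)
    (hpD : ¬ (p : ℤ) ∣ NumberField.discr K) (q : ℕ) [Fact q.Prime] (hqN : q ∣ N)
    (hI : padicValNat p (AddSubgroup.zmultiples P).index ≤
      padicValNat p ((W.baseChange ℚ_[q]).localTamagawaNumber ℤ_[q]))
    (hr : W.analyticRank ≤ 1) {s : ℚ} (hs : shaAn W = (s : ℂ)) (hv : padicValRat p s = 0) :
    BSDp W p :=
  bsdp_of_mult_of_jetchevChaCertificate W p hMJ hGZK hmult hp2 hirr hK hH hP hnt hpD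
    (not_sq_dvd_level_of_isHeegnerPoint W p hC hmult hP) q hqN hI hr hs hv

/-! ### §2. On the cell's class X11b every Galois / reduction hypothesis is automatic -/

/-- **X11b, `p ∤ #Ш_an`, `p ∣ c_q`: `BSD(E,p)` from PUBLISHED theorems plus the Jetchev–Cha index
certificate.** On `ClassX11b W p` (`r = 1 ∧ p ≠ 2 ∧ mult(p) ∧ irr(p)`, RESIDUAL-CASES §a.2 v5 row 11)
the hypotheses "`E` non-CM", "`p` odd", "`ρ̄_{E,p}` irreducible", "`r_an ≤ 1`" of Miller's Thm. 5.4
in the Cha case hold by definition of the class; no surjectivity, no (ram) witness, no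
semistability is asked. What remains per pair: the Heegner field `K` (`p ∤ d_K`), `p² ∤ N`, the
Heegner point `y_K` of infinite order, ONE prime `q ∣ N` with `ord_p [E(K) : ℤ y_K] ≤ ord_p c_q`,
and `p ∤ #Ш_an`. FLAGS `Miller11-Thm54-Cha-case`, `JET@p|N` (booked literal or PUB at the
referee's discretion). NOT a class theorem; X11b's label is unchanged.
[cite: Miller2011LMS, Thm. 5.4 and Def. 1.1] [cite: Jetchev2008, Cor. 1.5 (p. 3)] -/
theorem ClassX11b.bsdp_of_jetchevChaCertificate
    (hMJ : thm54_cha_padicValNat_shaOrder_add_tamagawa_le)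
    (hGZK : rank_eq_analyticRank_of_analyticRank_le_one) (hX : ClassX11b W p)
    {N : ℕ} [NeZero N] {K : Type} [Field K] [NumberField K] (hK : IsImaginaryQuadratic K)
    (hH : SatisfiesHeegnerHypothesis N K) {P : (W.baseChange K).toAffine.Point}
    (hP : IsHeegnerPoint N W K P) (hnt : ¬ IsOfFinAddOrder P)
    (hpD : ¬ (p : ℤ) ∣ NumberField.discr K) (hpN : ¬ p ^ 2 ∣ N)
    (q : ℕ) [Fact q.Prime] (hqN : q ∣ N)
    (hI : padicValNat p (AddSubgroup.zmultiples P).index ≤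
      padicValNat p ((W.baseChange ℚ_[q]).localTamagawaNumber ℤ_[q]))
    {s : ℚ} (hs : shaAn W = (s : ℂ)) (hv : padicValRat p s = 0) : BSDp W p := by
  obtain ⟨hr1, hp2, hmult, hirr⟩ := hX
  exact bsdp_of_mult_of_jetchevChaCertificate W p hMJ hGZK hmult hp2 hirr hK hH hP hnt hpD hpN q hqN
    hI (le_of_eq hr1) hs hv

/-- **X11b, `p ∤ #Ш_an`, `p ∣ c_q`, Carayol granted: `BSD(E,p)` from the Jetchev–Cha certificate
with `p² ∤ N` discharged.** FLAGS `Miller11-Thm54-Cha-case`, `JET@p|N`. NOT a class theorem.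
[cite: Miller2011LMS, Thm. 5.4 and Def. 1.1] [cite: Carayol1986, Thm. (A)] -/
theorem ClassX11b.bsdp_of_jetchevChaCertificate_of_carayol
    (hMJ : thm54_cha_padicValNat_shaOrder_add_tamagawa_le)
    (hGZK : rank_eq_analyticRank_of_analyticRank_le_one)
    (hC : ∀ (M : ℕ) [NeZero M], IsNewformOf.level_eq_conductorNorm (N := M)) (hX : ClassX11b W p)
    {N : ℕ} [NeZero N] {K : Type} [Field K] [NumberField K] (hK : IsImaginaryQuadratic K)
    (hH : SatisfiesHeegnerHypothesis N K) {P : (W.baseChange K).toAffine.Point}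
    (hP : IsHeegnerPoint N W K P) (hnt : ¬ IsOfFinAddOrder P)
    (hpD : ¬ (p : ℤ) ∣ NumberField.discr K) (q : ℕ) [Fact q.Prime] (hqN : q ∣ N)
    (hI : padicValNat p (AddSubgroup.zmultiples P).index ≤
      padicValNat p ((W.baseChange ℚ_[q]).localTamagawaNumber ℤ_[q]))
    {s : ℚ} (hs : shaAn W = (s : ℂ)) (hv : padicValRat p s = 0) : BSDp W p := by
  obtain ⟨hr1, hp2, hmult, hirr⟩ := hX
  exact bsdp_of_mult_of_jetchevChaCertificate_of_carayol W p hMJ hGZK hC hmult hp2 hirr hK hH hP hnt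
    hpD q hqN hI (le_of_eq hr1) hs hv

/-- **X11b: the PRINTED numeric bound `ord_p #Ш(E/ℚ) ≤ 2(v − w)`** from Miller's Thm. 5.4 in the Cha
case, given `ord_p [E(K) : ℤ y_K] ≤ v` (the computed Heegner index) and `w ≤ ord_p c_q` at one
prime `q ∣ N` (in `ℕ`, truncated at `0`). This is what print gives at the pairs that STAY: e.g. two
bad primes with `p ∥ c_q` each and `ord_p m = 2` in every Heegner field yield only `ord_p #Ш ≤ 2`
(`v = 2`, `w = 1`). FLAGS `Miller11-Thm54-Cha-case`, `JET@p|N`. Per pair; not a class theorem.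
[cite: Miller2011LMS, Thm. 5.4 (arXiv:1010.2431 p. 11)] -/
theorem ClassX11b.padicValNat_shaOrder_le_of_jetchevCha
    (hMJ : thm54_cha_padicValNat_shaOrder_add_tamagawa_le) (hX : ClassX11b W p)
    {N : ℕ} [NeZero N] {K : Type} [Field K] [NumberField K] (hK : IsImaginaryQuadratic K)
    (hH : SatisfiesHeegnerHypothesis N K) {P : (W.baseChange K).toAffine.Point}
    (hP : IsHeegnerPoint N W K P) (hnt : ¬ IsOfFinAddOrder P)
    (hpD : ¬ (p : ℤ) ∣ NumberField.discr K) (hpN : ¬ p ^ 2 ∣ N)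
    (q : ℕ) [Fact q.Prime] (hqN : q ∣ N) {v w : ℕ}
    (hv : padicValNat p (AddSubgroup.zmultiples P).index ≤ v)
    (hw : w ≤ padicValNat p ((W.baseChange ℚ_[q]).localTamagawaNumber ℤ_[q])) :
    padicValNat p W.shaOrder ≤ 2 * (v - w) := by
  obtain ⟨hr1, hp2, hmult, hirr⟩ := hX
  exact padicValNat_shaOrder_le_of_index_sub_tamagawa hMJ W hK hH hP hnt p q hqN
    (fun hCM ↦ not_mult_of_hasCM W hCM p hmult) hp2 hpD hpN hirr (le_of_eq hr1) hv hw

/-- **X11b: the typed missing `p`-part is DISCHARGED, pair by pair, by the Jetchev–Cha certificate**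
(for `p ∤ #Ш_an`): `Typed.MissingPPartAt W p` holds at every X11b pair carrying the certificate (`Ш`
is finite by GZK in analytic rank `1`). Bookkeeping only; the class stays typed; FLAGS
`Miller11-Thm54-Cha-case`, `JET@p|N` on the binder `hMJ`. [cite: Miller2011LMS, Thm. 5.4 and Def. 1.1] -/
theorem ClassX11b.missingPPartAt_of_jetchevChaCertificate
    (hMJ : thm54_cha_padicValNat_shaOrder_add_tamagawa_le)
    (hGZK : rank_eq_analyticRank_of_analyticRank_le_one) (hX : ClassX11b W p)
    {N : ℕ} [NeZero N] {K : Type} [Field K] [NumberField K] (hK : IsImaginaryQuadratic K)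
    (hH : SatisfiesHeegnerHypothesis N K) {P : (W.baseChange K).toAffine.Point}
    (hP : IsHeegnerPoint N W K P) (hnt : ¬ IsOfFinAddOrder P)
    (hpD : ¬ (p : ℤ) ∣ NumberField.discr K) (hpN : ¬ p ^ 2 ∣ N)
    (q : ℕ) [Fact q.Prime] (hqN : q ∣ N)
    (hI : padicValNat p (AddSubgroup.zmultiples P).index ≤
      padicValNat p ((W.baseChange ℚ_[q]).localTamagawaNumber ℤ_[q]))
    {s : ℚ} (hs : shaAn W = (s : ℂ)) (hv : padicValRat p s = 0) : MissingPPartAt W p := by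
  haveI : Finite W.sha := (hGZK W (le_of_eq hX.1)).2
  exact missingPPartAt_of_bsdp W p
    (ClassX11b.bsdp_of_jetchevChaCertificate W p hMJ hGZK hX hK hH hP hnt hpD hpN q hqN hI hs hv)

end Summit.BirchSwinnertonDyer.Rank1Residual.X11b

end
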